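import Summits.BirchSwinnertonDyer.Rank1Residual.ManinAdditive.TowerExtension
import HarnessLib

/-!
# E-an-142 `TVPatternRigidity`, step (5.0) RESOLUTION: under TV from level `s+1` and the `T_q`-relations every level `n ≥ s`
# has period `qˢ` on the integers prime to `q`

Summit `BirchSwinnertonDyer`, route `ManinLocalTwoThree` (cell bsd-f2-manin), cruxes C2 `ManinOddAtFour` (stmt-BirchSwinnertonDyer-22967) /
C3 `ManinPrimeToThreeAtNine` (stmt-…-22968) through the tower input E-an-135 ⟸ E-an-142 (`TowerExtension.TVPatternRigidity`, typer p672452;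
an g30 MEMO-an §72.9–72.10, PROOFS-an-72 §5).  Prover seat bsd-line-manin23-p1 (C2/C3 LEAD), gen 10: the `[S]` stub `stub_resolution` of the an
planner's L9 skeleton `HOME/an/g30/TowerRigiditySkeleton-an-g30.lean`, BY VALUE (the skeleton's bundle `TVHyp` is not a tree object; the
hypotheses below are its fields `period`, `unreduce`, `tv`, `kappa`, `hecke`, `level0` verbatim, so the skeleton's `stub_resolution H` is
`tv_resolution hq hqp H.level0 H.period H.unreduce H.tv H.kappa H.hecke` with `hqp` from `H.qprime`, `H.not_dvd`).

THE STATEMENT (PROOFS-an-72 §5 (5.0) = THEOREM Z (1.1)): `∀ n r t, s ≤ n → IsCoprime r q → g n (r + t·qˢ) = g n r`.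
THE PROOF.  `s ≥ 1` (`tv_resolution_of_pos`): level `s` by (P1); level `s+1` by (TV) (the step `r ↦ r + qˢ` preserves `q ∤ r`); level `m+1 ≥ s+2`
from levels `m, m−1`: (TV) at level `m+1` makes the `q` summands of (HK) at `m` equal, so `q̄·g(m+1, r) = a·g(m, r) − g(m−1, r) + κ`, whose right
side has period `qˢ` in `r`; `q̄ ∈ (ℤ/p)ˣ` (`q ∤ p`).  `s = 0` (`eq_zero_of_tv_zero`): (TV) at level `1` chains `r ↦ r + 1` through the multiples of
`q`, so `g(1, ·)` is constant `= g(1, q·0) = g(0, 0) = 0`, hence `κ = 0`, and (HK) + (P2) kill every level: `g ≡ 0`.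
Everything is elementary (no modular forms); `a` and the admissibility `p ∤ (q−1)/2` are not used here.

HONEST FRAMING: one of three stubs of the E-an-142 skeleton (the other two, class-independence via LEMMA MH and linearity, are NOT proved here);
E-an-142, E-an-135, C2, C3, Manin's conjecture and BSD are NOT proved by this file.  No definitions, no sorry.
-/

set_option autoImplicit false
set_option linter.dupNamespace false

namespace Summit.BirchSwinnertonDyer.BirchSwinnertonDyer.Theorems.ManinLocalTwoThree

open Finset

/-! ### §1. Integer iteration of a one-step period -/

/-- One-step invariance `φ (r + d) = φ r` on a set `P` stable under `r ↦ r ± d` iterates to `φ (r + k·d) = φ r` for all `k : ℤ`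
(and `P` is preserved). [folklore] -/
theorem apply_add_int_mul_eq_of_step {X : Type*} (φ : ℤ → X) (P : ℤ → Prop) (d : ℤ)
    (hP : ∀ r, P r → P (r + d)) (hP' : ∀ r, P r → P (r - d)) (hφ : ∀ r, P r → φ (r + d) = φ r) :
    ∀ (k : ℤ) (r : ℤ), P r → P (r + k * d) ∧ φ (r + k * d) = φ r := by
  intro k
  induction k using Int.induction_on with
  | zero => intro r hr; simpa using hr
  | succ k ih =>
    intro r hr
    obtain ⟨hPk, hφk⟩ := ih r hr
    have e : r + ((k : ℤ) + 1) * d = (r + k * d) + d := by ring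
    rw [e]
    exact ⟨hP _ hPk, (hφ _ hPk).trans hφk⟩
  | pred k ih =>
    intro r hr
    obtain ⟨hPk, hφk⟩ := ih r hr
    have e : r + (-(k : ℤ) - 1) * d = (r + (-(k : ℤ)) * d) - d := by ring
    rw [e]
    refine ⟨hP' _ hPk, ?_⟩
    have h := hφ _ (hP' _ hPk)
    rw [sub_add_cancel] at h
    exact h.symm.trans hφk

/-- Unconditional version (`P = ⊤`): `φ (r + d) = φ r` for all `r` gives `φ (r + k·d) = φ r` for all `k : ℤ`. [folklore] -/
theorem apply_add_int_mul_eq_of_forall_step {X : Type*} (φ : ℤ → X) (d : ℤ) (hφ : ∀ r, φ (r + d) = φ r)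
    (k r : ℤ) : φ (r + k * d) = φ r :=
  (apply_add_int_mul_eq_of_step φ (fun _ ↦ True) d (fun _ _ ↦ trivial) (fun _ _ ↦ trivial) (fun r _ ↦ hφ r) k r
    trivial).2

/-- `q ∤ r` is preserved by `r ↦ r + k·qᵉ` for `e ≥ 1`. [folklore] -/
theorem isCoprime_add_mul_pow {q : ℤ} {r : ℤ} (hr : IsCoprime r q) (k : ℤ) {e : ℕ} (he : 1 ≤ e) :
    IsCoprime (r + k * q ^ e) q := by
  obtain ⟨e', rfl⟩ := Nat.exists_eq_add_of_le he
  have e1 : r + k * q ^ (1 + e') = r + (k * q ^ e') * q := by ring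
  rw [e1]
  exact hr.add_mul_right_left _

/-! ### §2. The Hecke sum collapses under TV -/

section Resolution

variable {p q : ℕ} (g : ℕ → ℤ → ZMod p)

/-- If the `q` summands `g (m+1) (r + t·qᵐ)` all equal `g (m+1) r`, the Hecke sum is `q̄ · g (m+1) r`. [folklore] -/
theorem sum_range_eq_natCast_mul {m : ℕ} {r : ℤ} (h : ∀ t ∈ range q, g (m + 1) (r + (t : ℤ) * (q : ℤ) ^ m) = g (m + 1) r) :
    ∑ t ∈ range q, g (m + 1) (r + (t : ℤ) * (q : ℤ) ^ m) = (q : ZMod p) * g (m + 1) r := by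
  rw [sum_congr rfl h, sum_const, card_range, nsmul_eq_mul]

/-- TV at level `m+1 ≥ 2` (period `qᵐ` on the integers prime to `q`, `m ≥ 1`) collapses the Hecke sum at a point `r` prime to `q`.
[folklore] -/
theorem sum_range_eq_natCast_mul_of_tv {m : ℕ} (hm : 1 ≤ m)
    (tvm : ∀ r : ℤ, IsCoprime r (q : ℤ) → g (m + 1) (r + (q : ℤ) ^ m) = g (m + 1) r) {r : ℤ} (hr : IsCoprime r (q : ℤ)) :
    ∑ t ∈ range q, g (m + 1) (r + (t : ℤ) * (q : ℤ) ^ m) = (q : ZMod p) * g (m + 1) r := by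
  refine sum_range_eq_natCast_mul g fun t _ ↦ ?_
  exact (apply_add_int_mul_eq_of_step (g (m + 1)) (fun x ↦ IsCoprime x (q : ℤ)) ((q : ℤ) ^ m)
    (fun x hx ↦ by simpa using isCoprime_add_mul_pow hx 1 hm)
    (fun x hx ↦ by simpa [sub_eq_add_neg] using isCoprime_add_mul_pow hx (-1) hm) tvm (t : ℤ) r hr).2

/-! ### §3. The case `s ≥ 1` -/

/-- **RESOLUTION for `s ≥ 1`** (PROOFS-an-72 §5 (5.0) / THEOREM Z (1.1)): with (P1) `period`, (TV) from level `s+1` and the `T_q`-relations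
(HK), every level `n ≥ s` has period `qˢ` on the integers prime to `q` (`q` prime, `q ∤ p`).  Induction on `n`: levels `s` (P1) and `s+1` (TV);
for `m+1 ≥ s+2`, (TV) collapses the Hecke sum at `m` to `q̄·g(m+1,·)`, the right side has period `qˢ` by the hypothesis at `m, m−1`, and `q̄`
is a unit of `ℤ/p`. -/
theorem tv_resolution_of_pos {s : ℕ} (hq : q.Prime) (hqp : ¬ q ∣ p) (hs : 1 ≤ s) (a κ : ZMod p)
    (period : ∀ (n : ℕ) (r : ℤ), g n (r + (q : ℤ) ^ n) = g n r)
    (tv : ∀ (n : ℕ) (r : ℤ), s + 1 ≤ n → IsCoprime r (q : ℤ) → g n (r + (q : ℤ) ^ (n - 1)) = g n r)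
    (hecke : ∀ (m : ℕ) (r : ℤ),
      ∑ t ∈ range q, g (m + 1) (r + (t : ℤ) * (q : ℤ) ^ m) = a * g m r - g (m - 1) r + κ) :
    ∀ (n : ℕ) (r t : ℤ), s ≤ n → IsCoprime r (q : ℤ) → g n (r + t * (q : ℤ) ^ s) = g n r := by
  have hunit : IsUnit ((q : ℕ) : ZMod p) :=
    (ZMod.isUnit_iff_coprime q p).mpr ((Nat.Prime.coprime_iff_not_dvd hq).mpr hqp)
  -- `R d` : level `s + d` has period `qˢ` on units; two-step induction on `d`
  have key : ∀ d : ℕ, ∀ (r t : ℤ), IsCoprime r (q : ℤ) → g (s + d) (r + t * (q : ℤ) ^ s) = g (s + d) r := by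
    intro d
    induction d using Nat.strong_induction_on with
    | _ d ih =>
      intro r t hr
      rcases Nat.lt_or_ge d 2 with hd | hd
      · interval_cases d
        · -- level `s`: (P1)
          simpa using apply_add_int_mul_eq_of_forall_step (g s) ((q : ℤ) ^ s) (period s) t r
        · -- level `s + 1`: (TV)
          have tv1 : ∀ x : ℤ, IsCoprime x (q : ℤ) → g (s + 1) (x + (q : ℤ) ^ s) = g (s + 1) x := fun x hx ↦ by
            simpa using tv (s + 1) x le_rfl hx
          exact (apply_add_int_mul_eq_of_step (g (s + 1)) (fun x ↦ IsCoprime x (q : ℤ)) ((q : ℤ) ^ s)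
            (fun x hx ↦ by simpa using isCoprime_add_mul_pow hx 1 hs)
            (fun x hx ↦ by simpa [sub_eq_add_neg] using isCoprime_add_mul_pow hx (-1) hs) tv1 t r hr).2
      · -- level `m + 1 = s + d`, `m = s + (d - 1) ≥ s + 1`
        obtain ⟨d', rfl⟩ := Nat.exists_eq_add_of_le hd
        set m := s + d' + 1 with hm
        have hm1 : 1 ≤ m := by omega
        have hlev : s + (2 + d') = m + 1 := by omega
        rw [hlev]
        have hr' : IsCoprime (r + t * (q : ℤ) ^ s) (q : ℤ) := isCoprime_add_mul_pow hr t hs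
        have tvm : ∀ x : ℤ, IsCoprime x (q : ℤ) → g (m + 1) (x + (q : ℤ) ^ m) = g (m + 1) x := fun x hx ↦ by
          simpa using tv (m + 1) x (by omega) hx
        have h1 := sum_range_eq_natCast_mul_of_tv g hm1 tvm hr
        have h2 := sum_range_eq_natCast_mul_of_tv g hm1 tvm hr'
        rw [hecke] at h1 h2
        -- the right sides agree by the induction hypothesis at levels `m` and `m - 1`
        have em : m = s + (d' + 1) := by omega
        have em1 : m - 1 = s + d' := by omega
        have ihm : g m (r + t * (q : ℤ) ^ s) = g m r := by
          rw [em]; exact ih (d' + 1) (by omega) r t hr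
        have ihm1 : g (m - 1) (r + t * (q : ℤ) ^ s) = g (m - 1) r := by
          rw [em1]; exact ih d' (by omega) r t hr
        rw [ihm, ihm1, h1] at h2
        exact (hunit.mul_right_inj.mp h2).symm
  intro n r t hn hr
  obtain ⟨d, rfl⟩ := Nat.exists_eq_add_of_le hn
  exact key d r t hr

/-! ### §4. The case `s = 0`: everything vanishes -/

/-- **TV from level `1` kills `g`**: with (P0), (P1), (P2), (TV) for all `n ≥ 1`, `κ = Σ_{t<q} g(1,t)` and (HK) (`q` prime, `q ∤ p`),
`g n x = 0` for all `n, x`.  (TV) at level `1` reads `g(1, r+1) = g(1, r)` for `q ∤ r`, which chains `1 → 2 → ⋯ → q`; with the period `q` and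
`g(1, q·0) = g(0, 0) = 0` this gives `g(1, ·) ≡ 0`, so `κ = 0`; then (HK) at `m ≥ 1` (collapsed by TV) and (P2) propagate the vanishing. -/
theorem eq_zero_of_tv_zero (hq : q.Prime) (hqp : ¬ q ∣ p) (a κ : ZMod p)
    (level0 : ∀ r : ℤ, g 0 r = 0)
    (period : ∀ (n : ℕ) (r : ℤ), g n (r + (q : ℤ) ^ n) = g n r)
    (unreduce : ∀ (n : ℕ) (r : ℤ), g (n + 1) ((q : ℤ) * r) = g n r)
    (tv : ∀ (n : ℕ) (r : ℤ), 0 + 1 ≤ n → IsCoprime r (q : ℤ) → g n (r + (q : ℤ) ^ (n - 1)) = g n r)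
    (kappa : κ = ∑ t ∈ range q, g 1 (t : ℤ))
    (hecke : ∀ (m : ℕ) (r : ℤ),
      ∑ t ∈ range q, g (m + 1) (r + (t : ℤ) * (q : ℤ) ^ m) = a * g m r - g (m - 1) r + κ) :
    ∀ (n : ℕ) (x : ℤ), g n x = 0 := by
  have hunit : IsUnit ((q : ℕ) : ZMod p) :=
    (ZMod.isUnit_iff_coprime q p).mpr ((Nat.Prime.coprime_iff_not_dvd hq).mpr hqp)
  have hqprime : Prime (q : ℤ) := Nat.prime_iff_prime_int.mp hq
  -- level 1 vanishes
  have h1q : g 1 (q : ℤ) = 0 := by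
    have h := unreduce 0 1
    rwa [mul_one, level0] at h
  have h10 : g 1 0 = 0 := by
    have h := unreduce 0 0
    rwa [mul_zero, level0] at h
  have tv1 : ∀ r : ℤ, IsCoprime r (q : ℤ) → g 1 (r + 1) = g 1 r := fun r hr ↦ by
    simpa using tv 1 r le_rfl hr
  have h1nat : ∀ j : ℕ, 1 ≤ j → j ≤ q → g 1 (j : ℤ) = g 1 1 := by
    intro j hj
    induction j, hj using Nat.le_induction with
    | base => intro; simp
    | succ j hj ih =>
      intro hjq
      have hjcop : IsCoprime (j : ℤ) (q : ℤ) :=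
        Nat.isCoprime_iff_coprime.mpr (Nat.Coprime.symm ((Nat.Prime.coprime_iff_not_dvd hq).mpr fun h ↦ by
          have := Nat.le_of_dvd (by omega) h; omega))
      rw [← ih (by omega)]
      push_cast
      exact tv1 (j : ℤ) hjcop
  have h11 : g 1 1 = 0 := (h1nat q hq.one_lt.le le_rfl).symm.trans h1q
  have hper : ∀ (k r : ℤ), g 1 (r + k * (q : ℤ)) = g 1 r := fun k r ↦ by
    simpa using apply_add_int_mul_eq_of_forall_step (g 1) ((q : ℤ) ^ 1) (period 1) k r
  have h1 : ∀ x : ℤ, g 1 x = 0 := by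
    intro x
    have hq0 : (0 : ℤ) < q := by exact_mod_cast hq.pos
    have hj0 : 0 ≤ x % q := Int.emod_nonneg _ hq0.ne'
    have hjq : x % q < q := Int.emod_lt_of_pos _ hq0
    have hx : x = x % q + (x / q) * q := by
      have h := Int.emod_add_mul_ediv x q
      linarith [mul_comm (q : ℤ) (x / q)]
    rw [hx, hper]
    obtain ⟨jn, hjn⟩ : ∃ jn : ℕ, (jn : ℤ) = x % q := ⟨(x % q).toNat, Int.toNat_of_nonneg hj0⟩
    rw [← hjn]
    rcases Nat.eq_zero_or_pos jn with rfl | hjpos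
    · exact_mod_cast h10
    · rw [h1nat jn hjpos (by omega), h11]
  have hκ : κ = 0 := by
    rw [kappa]
    exact sum_eq_zero fun t _ ↦ h1 t
  -- all levels vanish, by strong induction on `n` for level `n + 1`
  have main : ∀ n : ℕ, ∀ x : ℤ, g (n + 1) x = 0 := by
    intro n
    induction n using Nat.strong_induction_on with
    | _ n ih =>
      intro x
      rcases Nat.eq_zero_or_pos n with rfl | hn
      · exact h1 x
      · obtain ⟨n', rfl⟩ := Nat.exists_eq_add_one_of_ne_zero (by omega : n ≠ 0)
        by_cases hx : IsCoprime x (q : ℤ)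
        · -- a unit: collapse the Hecke sum at `m = n' + 1`
          have tvm : ∀ y : ℤ, IsCoprime y (q : ℤ) → g (n' + 1 + 1) (y + (q : ℤ) ^ (n' + 1)) = g (n' + 1 + 1) y :=
            fun y hy ↦ by simpa using tv (n' + 1 + 1) y (by omega) hy
          have h := sum_range_eq_natCast_mul_of_tv g (by omega) tvm hx
          rw [hecke, hκ, add_zero] at h
          have hgn : g (n' + 1) x = 0 := ih n' (by omega) x
          have hgn1 : g (n' + 1 - 1) x = 0 := by
            rw [Nat.add_sub_cancel]
            rcases Nat.eq_zero_or_pos n' with rfl | h2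
            · exact level0 x
            · obtain ⟨n'', rfl⟩ := Nat.exists_eq_add_one_of_ne_zero (by omega : n' ≠ 0)
              exact ih n'' (by omega) x
          rw [hgn, hgn1, mul_zero, zero_sub, neg_zero] at h
          exact hunit.mul_right_eq_zero.mp h.symm
        · -- a multiple of `q`: (P2)
          have hdvd : (q : ℤ) ∣ x := by
            by_contra hnd
            exact hx (isCoprime_comm.mp (hqprime.irreducible.coprime_iff_not_dvd.mpr hnd))
          obtain ⟨y, rfl⟩ := hdvd
          rw [unreduce]
          exact ih n' (by omega) y
  intro n x
  cases n with
  | zero => exact level0 x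
  | succ n => exact main n x

/-! ### §5. RESOLUTION for every `s` — the skeleton's `stub_resolution`, by value -/

/-- **(5.0) RESOLUTION** (PROOFS-an-72 §5; the `[S]` stub `stub_resolution` of the E-an-142 skeleton, BY VALUE): under (P0) `level0`, (P1) `period`,
(P2) `unreduce`, (TV) from level `s+1`, `κ = Σ_{t<q} g(1,t)` and the `T_q`-relations (HK), for a prime `q ∤ p`, every level `n ≥ s` has period `qˢ`
on the integers prime to `q`: `g n (r + t·qˢ) = g n r`.  (`s ≥ 1`: `tv_resolution_of_pos`; `s = 0`: `g ≡ 0` by `eq_zero_of_tv_zero`.)  The binders are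
those of `TowerExtension.TVPatternRigidity N q p` (`¬ q ∣ p·N` gives `q ∤ p`); `a` and the admissibility `p ∤ (q−1)/2` are not used. -/
theorem tv_resolution {s : ℕ} (hq : q.Prime) (hqp : ¬ q ∣ p) (a κ : ZMod p)
    (level0 : ∀ r : ℤ, g 0 r = 0)
    (period : ∀ (n : ℕ) (r : ℤ), g n (r + (q : ℤ) ^ n) = g n r)
    (unreduce : ∀ (n : ℕ) (r : ℤ), g (n + 1) ((q : ℤ) * r) = g n r)
    (tv : ∀ (n : ℕ) (r : ℤ), s + 1 ≤ n → IsCoprime r (q : ℤ) → g n (r + (q : ℤ) ^ (n - 1)) = g n r)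
    (kappa : κ = ∑ t ∈ range q, g 1 (t : ℤ))
    (hecke : ∀ (m : ℕ) (r : ℤ),
      ∑ t ∈ range q, g (m + 1) (r + (t : ℤ) * (q : ℤ) ^ m) = a * g m r - g (m - 1) r + κ) :
    ∀ (n : ℕ) (r t : ℤ), s ≤ n → IsCoprime r (q : ℤ) → g n (r + t * (q : ℤ) ^ s) = g n r := by
  rcases Nat.eq_zero_or_pos s with rfl | hs
  · intro n r t _ _
    have h := eq_zero_of_tv_zero g hq hqp a κ level0 period unreduce tv kappa hecke
    rw [h, h]
  · exact tv_resolution_of_pos g hq hqp hs a κ period tv hecke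

/-- `¬ q ∣ p·N` (the binder of `TVPatternRigidity`) gives `¬ q ∣ p`. [folklore] -/
theorem not_dvd_of_not_dvd_mul_level {q p N : ℕ} (h : ¬ q ∣ p * N) : ¬ q ∣ p :=
  fun hd ↦ h (hd.mul_right N)

end Resolution

end Summit.BirchSwinnertonDyer.BirchSwinnertonDyer.Theorems.ManinLocalTwoThree
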